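import Mathlib.Analysis.Distribution.TemperedDistribution
import Mathlib.Probability.Distributions.Gaussian.Basic
import Mathlib.MeasureTheory.Constructions.BorelSpace.Basic
import Mathlib.MeasureTheory.Measure.ProbabilityMeasure
import HarnessLib

-- provenance: harness21/H21/H21/Prelude/QLatticeAQFT/RandomField.lean @ 154134c (interim HEAD d8f2665); M5 mechanical rewrite
/-!
# Random fields: probability laws on real tempered distributions

Trunk **T-AQFT** (G13, Part A, item A1), families `constructive-qft`, `crit-ising`.
Notions: `random_distribution_law`, `schwinger_functions` (moments), `nuclear_space_minlos`
(vocabulary only).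

A *Euclidean random field* over a real normed space `E` (typically
`EuclideanSpace ℝ (Fin d)`) is a probability measure `μ` on the space of real tempered
distributions `𝓢(E, ℝ) →L[ℝ] ℝ` with its weak-* (pointwise convergence) topology and Borel
σ-algebra. This file provides

* `Literature.AQFT.FieldConfig E := 𝓢(E, ℝ) →Lₚₜ[ℝ] ℝ`, its Borel measurable structure, evaluation maps,
  Dirac configurations `deltaConfig x`, and the complexification of test functions `ofRealTest`;
* the generating (characteristic) functional `genFunctional μ f = ∫ exp (i ω(f)) dμ(ω)`, moments
  (Schwinger functions smeared against test functions) `moment μ n f`, `twoPoint`,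
  `truncatedTwoPoint`, and the predicates `HasAllMoments`, `IsCentered`, `IsGaussianField`,
  `IsNonGaussian`, `HasMomentDensity` (moments given by locally integrable point functions),
  `HasBoundedNondegenerateTwoPoint` (the hypothesis of Aizenman–Duminil-Copin 2021, Thm 1.2);
* convergence in law `TendstoInLaw` (pointwise convergence of generating functionals);
* Bochner–Minlos vocabulary `IsPositiveDefiniteFunctional`, `IsCharacteristicFunctional`.

## Sources

* J. Glimm, A. Jaffe, *Quantum Physics: a functional integral point of view* (2nd ed. 1987), §6.1
  (fields as measures on `𝒮'`, generating functionals, OS axioms), §6.2 (Gaussian fields).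
* I. M. Gel'fand, N. Ya. Vilenkin, *Generalized Functions IV* (1964), Ch. IV §3 (Minlos'
  theorem: characteristic functionals of measures on duals of nuclear spaces).
* M. Aizenman, H. Duminil-Copin, *Marginal triviality of the scaling limits of critical 4D Ising
  and `φ⁴₄` models*, Ann. Math. 194 (2021), Thm 1.2.

## Mathlib

Used: `PointwiseConvergenceCLM` (`→Lₚₜ`, weak-* topology, `ContinuousEvalConst`), `borel`,
`BoundedContinuousFunction.evalCLM`, `SchwartzMap.toBoundedContinuousFunctionCLM`,
`SchwartzMap.postcompCLM`, `Complex.ofRealCLM`, `ProbabilityTheory.IsGaussian` (Gaussian measures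
on a topological vector space, via `StrongDual`), `MeasureTheory.ProbabilityMeasure` (topology of
weak convergence, used for finite-dimensional distributions). Mathlib's `charFunDual` needs a
*normed* space and so does not apply to `FieldConfig E`; `genFunctional` is its analogue on the
weak-* dual of Schwartz space. Verified absent at the pin: `MeasurableSpace`/`BorelSpace`
instances on `PointwiseConvergenceCLM`, positive-definite functionals, Minlos' theorem.

## Design

* `FieldConfig` is an `abbrev` (the `ContinuousLinearMap` API — evaluation, `precomp`,
  `IsGaussian` — is used downstream), so the two Borel instances below are instances on Mathlib's
  type family `PointwiseConvergenceCLM (RingHom.id ℝ) 𝓢(E, ℝ) ℝ`; they were verified absent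
  upstream and are the unique sensible choice (outline §0, R9).
* No `abbrev` for `EuclideanSpace ℝ (Fin d)` (outline §0); everything is stated for a generic real
  normed space `E`, plus `[MeasureSpace E]` where integrals over `E` appear
  (`Module.finrank ℝ E` enters `HasBoundedNondegenerateTwoPoint` without a finite-dimensionality
  hypothesis; it is only consumed for `E = EuclideanSpace ℝ (Fin d)`).
* Integrals are Bochner integrals, hence carry the junk value `0` for non-integrable integrands;
  this is documented on `moment`, `HasMomentDensity`, `HasBoundedNondegenerateTwoPoint` and is
  guarded by `HasAllMoments` in statements that need it.
-/

open scoped SchwartzMap ComplexConjugate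
open MeasureTheory Filter Topology Complex

namespace Literature.MathematicalPhysics.QuantumLattice

variable {E : Type*} [NormedAddCommGroup E] [NormedSpace ℝ E]

/-! ### Field configurations -/

variable (E) in
/-- The space of *field configurations* over `E`: real tempered distributions
`𝓢(E, ℝ) →L[ℝ] ℝ` equipped with the weak-* topology (Mathlib's topology of pointwise convergence
`→Lₚₜ`). Glimm–Jaffe §6.1 (`𝒮'(ℝ^d)` real). [folklore] -/
abbrev FieldConfig : Type _ := 𝓢(E, ℝ) →Lₚₜ[ℝ] ℝ

/-- The Borel σ-algebra of the weak-* topology on `FieldConfig E`; equivalently (for the cylinder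
sets used in Glimm–Jaffe §6.1 / Minlos) the σ-algebra generated by the evaluations `ω ↦ ω f`.
This is an instance on Mathlib's `PointwiseConvergenceCLM`, verified absent upstream at the pin. [folklore] -/
noncomputable instance FieldConfig.instMeasurableSpace : MeasurableSpace (FieldConfig E) := borel _

/-- `FieldConfig E` carries its Borel σ-algebra by definition (instance on Mathlib's
`PointwiseConvergenceCLM`, verified absent upstream at the pin). Glimm–Jaffe §6.1. [folklore] -/
instance FieldConfig.instBorelSpace : BorelSpace (FieldConfig E) := ⟨rfl⟩

/-- Evaluation `ω ↦ ω f` of a random field at a test function is measurable (it is continuous for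
the weak-* topology). Glimm–Jaffe §6.1. [folklore] -/
theorem measurable_eval (f : 𝓢(E, ℝ)) : Measurable fun ω : FieldConfig E => ω f :=
  (continuous_eval_const f).measurable

/-- Point evaluation `f ↦ f x` of a real Schwartz function as a continuous linear map (the Dirac
distribution `δₓ` on test functions). Gel'fand–Vilenkin IV §3. Name fixed by the architect's
outline; note this is *not* Mathlib's `SchwartzMap.evalCLM` (which evaluates a vector-valued
Schwartz function's values at a vector, `𝓢(E, F →L G) → 𝓢(E, G)`), and lives in `Literature.AQFT`. [folklore] -/
noncomputable def evalCLM (x : E) : 𝓢(E, ℝ) →L[ℝ] ℝ :=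
  (BoundedContinuousFunction.evalCLM ℝ x).comp (SchwartzMap.toBoundedContinuousFunctionCLM ℝ E ℝ)

/-- Unfolding lemma for `evalCLM`: `evalCLM x f = f x` (the Dirac distribution,
Gel'fand–Vilenkin IV §3). [folklore] -/
@[simp]
theorem evalCLM_apply (x : E) (f : 𝓢(E, ℝ)) : evalCLM x f = f x := rfl

/-- The Dirac field configuration `δₓ : f ↦ f x`, an element of `FieldConfig E`; the real
analogue of Mathlib's `TemperedDistribution.delta` (which lives in `𝓢'(E, ℂ)`), built with the
same idiom `ContinuousLinearMap.toPointwiseConvergenceCLM`. Lattice fields `φ : Λ → ℝ` embed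
into `FieldConfig E` as `∑ x, φ x • deltaConfig x`
(Glimm–Jaffe §6.1; scaling limits, Aizenman–Duminil-Copin 2021 §1). [cite: AizenmanDuminilCopin2021, §1] -/
noncomputable def deltaConfig (x : E) : FieldConfig E :=
  ContinuousLinearMap.toPointwiseConvergenceCLM _ _ _ _ (evalCLM x)

/-- Unfolding lemma for `deltaConfig`: `δₓ(f) = f x` (Glimm–Jaffe §6.1). [folklore] -/
@[simp]
theorem deltaConfig_apply (x : E) (f : 𝓢(E, ℝ)) : deltaConfig x f = f x := rfl

/-- A finite linear combination of Dirac configurations with measurable real coefficients is a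
measurable `FieldConfig E`-valued map (used to push lattice Gibbs measures forward to laws of
random fields). Glimm–Jaffe §6.1. [folklore] -/
theorem measurable_finset_sum_smul_deltaConfig {Ω : Type*} [MeasurableSpace Ω] {ι : Type*}
    (s : Finset ι) (φ : ι → Ω → ℝ) (hφ : ∀ i, Measurable (φ i)) (x : ι → E) :
    Measurable fun w : Ω => ∑ i ∈ s, φ i w • deltaConfig (E := E) (x i) := by
  have hg : Continuous fun c : s → ℝ => ∑ i : s, c i • deltaConfig (E := E) (x i) := by
    refine PointwiseConvergenceCLM.continuous_of_continuous_eval fun f => ?_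
    simp only [FunLike.coe_sum, FunLike.coe_smul, Finset.sum_apply,
      Pi.smul_apply]
    fun_prop
  have hf : Measurable fun w : Ω => fun i : s => φ i w := measurable_pi_lambda _ fun i => hφ i
  have heq : (fun w : Ω => ∑ i ∈ s, φ i w • deltaConfig (E := E) (x i)) =
      (fun c : s → ℝ => ∑ i : s, c i • deltaConfig (E := E) (x i)) ∘ fun w i => φ i w := by
    funext w
    simp only [Function.comp_apply]
    exact (Finset.sum_coe_sort s (fun i => φ i w • deltaConfig (E := E) (x i))).symm
  rw [heq]
  exact hg.measurable.comp hf

/-- Complexification of real test functions, `f ↦ (x ↦ (f x : ℂ))`, as a continuous `ℝ`-linear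
map `𝓢(E, ℝ) →L[ℝ] 𝓢(E, ℂ)` (needed where Mathlib forces complex test functions, e.g. Fourier
transform). [folklore] -/
noncomputable def ofRealTest : 𝓢(E, ℝ) →L[ℝ] 𝓢(E, ℂ) :=
  SchwartzMap.postcompCLM Complex.ofRealCLM

/-- Unfolding lemma for `ofRealTest`: `ofRealTest f x = (f x : ℂ)` (complexified test functions,
Glimm–Jaffe §6.1). [folklore] -/
@[simp]
theorem ofRealTest_apply (f : 𝓢(E, ℝ)) (x : E) : ofRealTest f x = (f x : ℂ) := rfl

/-! ### Laws of random fields: generating functional and moments -/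

/-- The *generating functional* (characteristic functional, Fourier transform) of a law `μ` on
field configurations: `S(f) = ∫ exp (i ω(f)) dμ(ω)`. Glimm–Jaffe §6.1 (OS0 is stated on it);
Gel'fand–Vilenkin IV §3. Analogue of Mathlib's `charFunDual` (which needs a normed space). [folklore] -/
noncomputable def genFunctional (μ : Measure (FieldConfig E)) (f : 𝓢(E, ℝ)) : ℂ :=
  ∫ ω, cexp (I * (ω f : ℂ)) ∂μ

/-- The `n`-th *moment* (smeared Schwinger function) of a law `μ`:
`S_n(f_1, …, f_n) = ∫ ∏ᵢ ω(fᵢ) dμ(ω)`. Bochner integral: junk value `0` when the product is not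
integrable (guard with `HasAllMoments`). Glimm–Jaffe §6.1. [folklore] -/
noncomputable def moment (μ : Measure (FieldConfig E)) (n : ℕ) (f : Fin n → 𝓢(E, ℝ)) : ℝ :=
  ∫ ω, ∏ i, ω (f i) ∂μ

/-- The two-point function `⟨ω(f) ω(g)⟩_μ = ∫ ω(f) ω(g) dμ(ω)` (junk `0` if not integrable).
Glimm–Jaffe §6.1. [folklore] -/
noncomputable def twoPoint (μ : Measure (FieldConfig E)) (f g : 𝓢(E, ℝ)) : ℝ :=
  ∫ ω, ω f * ω g ∂μ

/-- The truncated (connected) two-point function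
`⟨ω(f); ω(g)⟩_μ = ⟨ω(f) ω(g)⟩ - ⟨ω(f)⟩⟨ω(g)⟩`. Glimm–Jaffe §6.1. [folklore] -/
noncomputable def truncatedTwoPoint (μ : Measure (FieldConfig E)) (f g : 𝓢(E, ℝ)) : ℝ :=
  twoPoint μ f g - (∫ ω, ω f ∂μ) * ∫ ω, ω g ∂μ

/-- `μ` has all moments: every evaluation `ω ↦ ω f` lies in `L^p(μ)` for all finite `p`, so that
all `moment μ n f` are genuine integrals. Glimm–Jaffe §6.1 (OS0 implies this). [folklore] -/
def HasAllMoments (μ : Measure (FieldConfig E)) : Prop :=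
  ∀ (p : NNReal) (f : 𝓢(E, ℝ)), MemLp (fun ω : FieldConfig E => ω f) p μ

/-- `μ` is centred: every evaluation is integrable with mean zero, `∫ ω(f) dμ = 0`.
Glimm–Jaffe §6.2. [folklore] -/
def IsCentered (μ : Measure (FieldConfig E)) : Prop :=
  ∀ f : 𝓢(E, ℝ), Integrable (fun ω : FieldConfig E => ω f) μ ∧ ∫ ω, ω f ∂μ = 0

/-- A *Gaussian (free-type) field*: a centred Gaussian measure on `FieldConfig E`, i.e. every
continuous linear functional (in particular every `ω ↦ ω f`) has a centred normal law
(Mathlib `ProbabilityTheory.IsGaussian`). Glimm–Jaffe §6.2. [folklore] -/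
def IsGaussianField (μ : Measure (FieldConfig E)) : Prop :=
  ProbabilityTheory.IsGaussian μ ∧ IsCentered μ

/-- `μ` is *non-Gaussian*: it is not a Gaussian measure (centred or not). Triviality statements
(Aizenman–Duminil-Copin 2021, Thm 1.2; Fröhlich 1982) assert the negation for scaling limits.
Caveat: Mathlib's `IsGaussian μ` implies `IsProbabilityMeasure μ`, so a non-probability (e.g.
zero or infinite) measure is trivially `IsNonGaussian`. Consumers obtain normalisation either from
`TendstoInLaw` (since `genFunctional μ 0 = μ.real univ`, any limit in law of probability laws has
mass `1`) or must assume `IsProbabilityMeasure μ` explicitly. [cite: AizenmanDuminilCopin2021, Thm 1.2] -/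
def IsNonGaussian (μ : Measure (FieldConfig E)) : Prop :=
  ¬ ProbabilityTheory.IsGaussian μ

section Density

variable [MeasureSpace E]

/-- The moments of `μ` are given by point functions `S n : (Fin n → E) → ℝ` (Schwinger functions
as functions): `S_n(f_1,…,f_n) = ∫ S n x ∏ᵢ fᵢ(xᵢ) dx` for all `n` and all test functions, the
integral over `Fin n → E` being with respect to the product `volume`. For
`E = EuclideanSpace ℝ (Fin d)` a `Literature.StatMech.CorrFamily d` is literally such an `S`.
Junk: the right-hand side is a Bochner integral, hence `0` when the (possibly singular on
diagonals) integrand is not integrable; consumers (crit-ising.S02) accept this as part of the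
assertion. Glimm–Jaffe §6.1; Osterwalder–Schrader (1973). [cite: OsterwalderSchrader1973] -/
def HasMomentDensity (μ : Measure (FieldConfig E)) (S : (n : ℕ) → (Fin n → E) → ℝ) : Prop :=
  ∀ (n : ℕ) (f : Fin n → 𝓢(E, ℝ)), moment μ n f = ∫ x, S n x * ∏ i, f i (x i)

/-- Hypothesis of Aizenman–Duminil-Copin, Ann. Math. 194 (2021), Thm 1.2 ("bounded non-degenerate
two-point function"), for a law `μ` over a finite-dimensional `E` (`d = finrank ℝ E`):
(i) every evaluation `ω ↦ ω f` is square integrable, so that `twoPoint μ` is a genuine integral;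
(ii) the two-point function is given by a point function `S₂`,
`⟨ω(f) ω(g)⟩ = ∫∫ S₂(x, y) f(x) g(y) dx dy`, with (iii) `|S₂(x, y)| ≤ C ‖x - y‖^{-(d-2)}`; and
(iv) the two-point function is not identically zero as a bilinear form on test functions
(equivalently `S₂ ≠ 0` as a distribution — non-degeneracy is stated on `twoPoint μ` itself, since
`S₂` is only determined almost everywhere). Junk: the real power `r ^ s` uses Mathlib's convention
for `0 ^ s` on the diagonal `x = y`, harmless for the intended `d ≥ 4` use (cqft.S24,
crit-ising.S13) where the bound is only consumed off the diagonal (a null set); and the iterated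
Bochner integral in (ii) is `0` when the integrand is not integrable (harmless given (i) and
(iv), and excluded anyway for Schwartz `f, g` by the bound (iii) when `d ≥ 3`). No
`FiniteDimensional ℝ E` hypothesis is taken: `Module.finrank ℝ E` is Mathlib's junk `0` for an
infinite-dimensional `E`, and all consumers instantiate `E = EuclideanSpace ℝ (Fin d)`. [folklore] -/
def HasBoundedNondegenerateTwoPoint (μ : Measure (FieldConfig E)) : Prop :=
  (∀ f : 𝓢(E, ℝ), MemLp (fun ω : FieldConfig E => ω f) 2 μ) ∧
  ∃ S₂ : E → E → ℝ,
    (∀ f g : 𝓢(E, ℝ), twoPoint μ f g = ∫ x, ∫ y, S₂ x y * f x * g y) ∧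
    (∃ C : ℝ, ∀ x y, |S₂ x y| ≤ C * ‖x - y‖ ^ (-(Module.finrank ℝ E - 2 : ℝ))) ∧
    ∃ f g : 𝓢(E, ℝ), twoPoint μ f g ≠ 0

end Density

/-! ### Convergence in law -/

/-- The finite-dimensional marginal map `ω ↦ (ω(f_k))_k` for a tuple of test functions.
Glimm–Jaffe §6.1. [folklore] -/
noncomputable def fddMap {n : ℕ} (f : Fin n → 𝓢(E, ℝ)) (ω : FieldConfig E) : Fin n → ℝ := fun k => ω (f k)

/-- Components of `fddMap`. [folklore] -/
@[simp]
theorem fddMap_apply {n : ℕ} (f : Fin n → 𝓢(E, ℝ)) (ω : FieldConfig E) (k : Fin n) :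
    fddMap f ω k = ω (f k) := rfl

/-- Finite-dimensional marginal maps are measurable (Glimm–Jaffe §6.1). [folklore] -/
theorem measurable_fddMap {n : ℕ} (f : Fin n → 𝓢(E, ℝ)) : Measurable (fddMap (E := E) f) :=
  measurable_pi_lambda _ fun k => measurable_eval (f k)

/-- Convergence in law of random fields along a filter `l`: pointwise convergence of the
generating functionals, `S_{μ_i}(f) → S_μ(f)` for every test function `f`. Weak convergence of
all finite-dimensional distributions implies it (`tendstoInLaw_of_fdd`), and along *countably
generated* filters (sequences; e.g. `atTop` on `ℕ`, `𝓝[>] 0` on `ℝ`) the two are equivalent by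
Lévy's continuity theorem and Cramér–Wold (`tendstoInLaw_iff_fdd`); for general nets pointwise
convergence of characteristic functionals is strictly weaker. On the nuclear space `𝒮` this is
the notion used for scaling limits (Aizenman–Duminil-Copin 2021 §1; Glimm–Jaffe §6.1). [cite: AizenmanDuminilCopin2021, §1] -/
def TendstoInLaw {ι : Type*} (μs : ι → Measure (FieldConfig E)) (l : Filter ι)
    (μ : Measure (FieldConfig E)) : Prop :=
  ∀ f : 𝓢(E, ℝ), Tendsto (fun i => genFunctional (μs i) f) l (𝓝 (genFunctional μ f))

/-! ### Bochner–Minlos vocabulary -/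

/-- A functional `C : 𝓢(E, ℝ) → ℂ` is *positive definite*: for all finite families of test
functions `fᵢ` and complex coefficients `cᵢ`, `∑ᵢⱼ conj cᵢ * cⱼ * C (fⱼ - fᵢ)` is a nonnegative
real. Gel'fand–Vilenkin IV §3 (Minlos' theorem). [folklore] -/
def IsPositiveDefiniteFunctional (C : 𝓢(E, ℝ) → ℂ) : Prop :=
  ∀ (n : ℕ) (f : Fin n → 𝓢(E, ℝ)) (c : Fin n → ℂ),
    0 ≤ (∑ i, ∑ j, conj (c i) * c j * C (f j - f i)).re ∧
      (∑ i, ∑ j, conj (c i) * c j * C (f j - f i)).im = 0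

/-- A *characteristic functional* on Schwartz space: `C 0 = 1`, `C` continuous, and positive
definite. By Minlos' theorem (Gel'fand–Vilenkin IV §3, Thm 3) these are exactly the generating
functionals of probability measures on `𝒮'`; here only the vocabulary is provided. [folklore] -/
def IsCharacteristicFunctional (C : 𝓢(E, ℝ) → ℂ) : Prop :=
  C 0 = 1 ∧ Continuous C ∧ IsPositiveDefiniteFunctional C

/-! ### API -/

/-- `|S_μ(f)| ≤ 1` for a probability law (the integrand `e^{iω(f)}` has norm one;
Glimm–Jaffe §6.1). [folklore] -/
theorem norm_genFunctional_le_one (μ : Measure (FieldConfig E)) [IsProbabilityMeasure μ]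
    (f : 𝓢(E, ℝ)) : ‖genFunctional μ f‖ ≤ 1 := by
  unfold genFunctional
  calc ‖∫ ω, cexp (I * (ω f : ℂ)) ∂μ‖ ≤ 1 * (μ Set.univ).toReal :=
        norm_integral_le_of_norm_le_const (by
          filter_upwards with ω
          rw [mul_comm]
          simp [Complex.norm_exp_ofReal_mul_I])
    _ = 1 := by simp

/-- The generating functional of a probability law is a characteristic functional (normalised,
weak-* sequentially/net continuous on `𝒮`, positive definite) — the easy half of Minlos' theorem.
Gel'fand–Vilenkin IV §3. [cite: GelfandVilenkinIV1964, Ch. IV §3] -/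
def isCharacteristicFunctional_genFunctional : Prop :=
  ∀ (μ : Measure (FieldConfig E)) [IsProbabilityMeasure μ],
    IsCharacteristicFunctional (genFunctional μ)

/-- Weak convergence of all finite-dimensional distributions `(ω(f_1), …, ω(f_n))` implies
convergence in law (of generating functionals), along any filter: `ω ↦ exp (i ω(f))` is a
bounded continuous function of the one-dimensional marginal. Glimm–Jaffe §6.1, Billingsley
*Convergence of Probability Measures* §1. [cite: BillingsleyCPM1999, §1 and Thm. 2.7 (continuous mapping)] -/
def tendstoInLaw_of_fdd : Prop :=
  ∀ {ι : Type*} (μs : ι → ProbabilityMeasure (FieldConfig E)) (l : Filter ι) (μ : ProbabilityMeasure (FieldConfig E)) (h : ∀ (n : ℕ) (f : Fin n → 𝓢(E, ℝ)), Tendsto (fun i => (μs i).map (measurable_fddMap f).aemeasurable) l (𝓝 (μ.map (measurable_fddMap f).aemeasurable))),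
    TendstoInLaw (fun i => (μs i : Measure (FieldConfig E))) l μ

/-- Along a countably generated filter (in particular for sequences), convergence in law (of
generating functionals) is equivalent to weak convergence of all finite-dimensional distributions
`(ω(f_1), …, ω(f_n))`. Lévy's continuity theorem (Mathlib
`MeasureTheory.ProbabilityMeasure.tendsto_of_tendsto_charFun`, stated for sequences, transferred
via `Filter.tendsto_iff_seq_tendsto` since `ProbabilityMeasure (Fin n → ℝ)` is metrizable) plus
Cramér–Wold; Glimm–Jaffe §6.1, Billingsley *Convergence of Probability Measures* §1. The
countability hypothesis is necessary: for general nets pointwise convergence of characteristic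
functions does not imply weak convergence. [cite: BillingsleyCPM1999, §1] -/
def tendstoInLaw_iff_fdd : Prop :=
  ∀ {ι : Type*} (μs : ι → ProbabilityMeasure (FieldConfig E)) (l : Filter ι) [l.IsCountablyGenerated] (μ : ProbabilityMeasure (FieldConfig E)),
    TendstoInLaw (fun i => (μs i : Measure (FieldConfig E))) l μ ↔
      ∀ (n : ℕ) (f : Fin n → 𝓢(E, ℝ)),
        Tendsto (fun i => (μs i).map (measurable_fddMap f).aemeasurable) l
          (𝓝 (μ.map (measurable_fddMap f).aemeasurable))

/-- The generating functional of a centred Gaussian field is `S(f) = exp (-½ ∫ ω(f)² dμ)`.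
Glimm–Jaffe §6.2, Prop. 6.2.2; cf. Mathlib `ProbabilityTheory.IsGaussian.charFunDual_eq`. [cite: GlimmJaffeQP1987, Prop. 6.2.2] -/
def IsGaussianField.genFunctional_eq : Prop :=
  ∀ {μ : Measure (FieldConfig E)} (hμ : IsGaussianField μ) (f : 𝓢(E, ℝ)),
    genFunctional μ f = cexp (-(1 / 2 : ℂ) * ((∫ ω, (ω f) ^ 2 ∂μ : ℝ) : ℂ))

/-- Two finite laws on `FieldConfig E` (over a finite-dimensional `E`, so that `𝓢(E, ℝ)` is a
separable nuclear Fréchet space and the Borel σ-algebra of the weak-* topology is generated by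
evaluations) with the same generating functional coincide. Gel'fand–Vilenkin IV §3;
cf. Mathlib `MeasureTheory.Measure.ext_of_charFunDual`. [cite: GelfandVilenkinIV1964, Ch. IV §3] -/
def ext_of_genFunctional : Prop :=
  ∀ [FiniteDimensional ℝ E] {μ ν : Measure (FieldConfig E)} [IsFiniteMeasure μ] [IsFiniteMeasure ν] (h : genFunctional μ = genFunctional ν),
    μ = ν

end Literature.MathematicalPhysics.QuantumLattice

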